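import Mathlib.MeasureTheory.SpecificCodomains.WithLp
import Literature.Analysis.FunctionSpaces.TorusConvolution
import HarnessLib

/-!
# Mollified fields on `T^d`: space mollification of vector fields and time averages

Analysis/FunctionSpaces definitions file (serves the discharge of Onsager rigidity,
`Literature.Analysis.FluidPDE.onsager_rigidity`, `FluidPDE/Onsager`; Constantin–E–Titi 1994, proof, p. 208:
"`u^ε = u * φ^ε`" and "the extra arguments needed to mollify in time"). It fixes the four
elementary operations from which the space–time test fields of the Constantin–E–Titi argument
are assembled, and the two fields assembled from them, so that the estimate files downstream
contain only theorems. The four operations: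

* `Torus.vecMollify ε u` — the componentwise spatial mollification `(u^ε)ᵢ = uᵢ ⋆ k_ε` of a
  vector field `u : T^d → ℝ^d` by the torus kernel `Torus.kernel ε` (tree convention of
  `TorusConvolution`: rough factor on the left);
* `Literature.timeAvgWith r G t x = (r ⋆ G(·, x))(t) = ∫ r(s) G(t - s, x) ds` — the time average of a
  space–time field `G : ℝ → X → F` against a time kernel `r` (Mathlib's convolution on `ℝ` in
  each fibre; for `r` a normalised bump this is the time mollification used by Serrin 1963, §4,
  and by the tree's `TimeMollification`);
* `Torus.timeAvgVec r U` — the componentwise time average of a space–time vector field;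
* `Torus.stKernel r ε (s, v) = r(s) ρ_ε(v)` — the product space–time kernel on `ℝ × ℝ^d`
  (time kernel `r`, spatial profile `Torus.profile ε`), through which space–time mollifications
  are read as Mathlib convolutions on `ℝ × ℝ^d` (the identification with `mollifiedField` is
  proved downstream, in the lift file that uses it).

The two fields:

* `Torus.mollifiedField φ ε U t = vecMollify ε (timeAvgVec ρ U t)`, `ρ = φ.normed volume` — the
  space–time mollification `w` of a velocity field `U : ℝ → T^d → ℝ^d`;
* `Torus.cetTestField φ ε η U t = vecMollify ε (timeAvgVec ρ (s ↦ η(s) • w(s)) t)` — the test field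
  obtained by mollifying the cut-off field `η • w` once more, with which the weak Euler
  formulation is tested in the Constantin–E–Titi argument.

Each definition comes with its unfolding lemmas; `vecMollify` moreover with smoothness for
`u ∈ L¹`.

## Mathlib search

Mathlib (this pin) has group convolution `MeasureTheory.convolution` (used here on `ℝ` and,
through the tree's `TorusConvolution`, on `UnitAddTorus d`) and bump functions; it has no
mollification API for vector fields on the torus or for time-dependent fields (searched
`UnitAddTorus`, `AddCircle` + `convolution`, `timeConv`).

## References

* P. Constantin, W. E, E. S. Titi, *Onsager's conjecture on the energy conservation for solutions
  of Euler's equation*, Comm. Math. Phys. 165 (1994), 207–209, p. 208.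
* J. Serrin, *The initial value problem for the Navier–Stokes equations*, in: Nonlinear Problems
  (Madison 1962), Univ. Wisconsin Press 1963, §4 (mollification in time).
-/

noncomputable section

open MeasureTheory TopologicalSpace Set Function Filter Topology Metric ContinuousLinearMap
open scoped Convolution ContDiff

namespace Literature.Analysis.FunctionSpaces

/-! ## Time averages in each fibre -/

section TimeAvg

variable {X : Type*} {F : Type*} [NormedAddCommGroup F] [NormedSpace ℝ F]

/-- The time average of a space–time field `G : ℝ → X → F` against a time kernel `r`:
`timeAvgWith r G t x = (r ⋆ G(·, x))(t) = ∫ r(s) G(t - s, x) ds` (Mathlib's convolution on `ℝ`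
in the fibre over `x`). For `r` a normalised even bump this is the mollification in time of
Serrin 1963, §4 ("`u_h = ∫ ω_h(t - τ) u(τ) dτ`"), in the form of the tree's `TimeMollification`.
[cite: Serrin1963, §4] -/
def timeAvgWith (r : ℝ → ℝ) (G : ℝ → X → F) (t : ℝ) (x : X) : F :=
  (r ⋆[lsmul ℝ ℝ, volume] fun σ => G σ x) t

/-- `timeAvgWith r G t x = ∫ r(s) • G(t - s, x) ds`. [folklore] -/
theorem timeAvgWith_apply (r : ℝ → ℝ) (G : ℝ → X → F) (t : ℝ) (x : X) :
    timeAvgWith r G t x = ∫ s, r s • G (t - s) x := by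
  simp only [timeAvgWith, convolution_def, lsmul_apply]

/-- `timeAvgWith r G t x = ∫ r(t - s) • G(s, x) ds`. [folklore] -/
theorem timeAvgWith_eq_integral_sub (r : ℝ → ℝ) (G : ℝ → X → F) (t : ℝ) (x : X) :
    timeAvgWith r G t x = ∫ s, r (t - s) • G s x := by
  simp only [timeAvgWith, convolution_lsmul_swap]

/-- The uncurried time average is the tree's fibrewise time convolution
(`Literature.Analysis.FunctionSpaces.stronglyMeasurable_timeConv`, `Literature.Analysis.FunctionSpaces.tendsto_eLpNorm_timeConv_sub`). [folklore] -/
theorem uncurry_timeAvgWith (r : ℝ → ℝ) (G : ℝ → X → F) :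
    uncurry (timeAvgWith r G) = fun z : ℝ × X => (r ⋆[lsmul ℝ ℝ, volume] fun σ => G σ z.2) z.1 :=
  rfl

/-- The time average of the zero field vanishes. [folklore] -/
@[simp]
theorem timeAvgWith_zero (r : ℝ → ℝ) : timeAvgWith r (0 : ℝ → X → F) = 0 := by
  funext t x
  simp [timeAvgWith_apply]

end TimeAvg

namespace Torus

variable {d : Type*} [Fintype d]

/-! ## Componentwise spatial mollification of vector fields -/

section Vec

/-- The componentwise mollification `u^ε` of a vector field `u : T^d → ℝ^d` by the torus kernel:
`(u^ε)ᵢ = uᵢ ⋆ k_ε` (Constantin–E–Titi 1994, p. 208: "`u^ε = u * φ^ε`", with the standard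
mollifier `φ^ε`; here `k_ε = Torus.kernel ε` and the tree's convention `θ ⋆ k`).
[cite: ConstantinETiti1994, p. 208] -/
def vecMollify (ε : ℝ) (u : UnitAddTorus d → EuclideanSpace ℝ d) (x : UnitAddTorus d) :
    EuclideanSpace ℝ d :=
  WithLp.toLp 2 fun i => ((fun y => u y i) ⋆ kernel ε) x

/-- Components of the mollified field: `(u^ε)(x)ᵢ = (uᵢ ⋆ k_ε)(x)`. [folklore] -/
@[simp]
theorem vecMollify_apply (ε : ℝ) (u : UnitAddTorus d → EuclideanSpace ℝ d) (x : UnitAddTorus d)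
    (i : d) : vecMollify ε u x i = ((fun y => u y i) ⋆ kernel ε) x := rfl

/-- Mollification of the zero field vanishes. [folklore] -/
@[simp]
theorem vecMollify_zero (ε : ℝ) : vecMollify ε (0 : UnitAddTorus d → EuclideanSpace ℝ d) = 0 := by
  funext x
  ext i
  simp [vecMollify_apply, convolution_def]

/-- The mollified field is smooth for `u ∈ L¹(T^d)` and `0 < ε ≤ 1/4` (componentwise
`Torus.isSmooth_convolution`; coordinates of an integrable field are integrable by Mathlib's
`MeasureTheory.Integrable.eval_piLp`). [folklore] -/
theorem isSmooth_vecMollify {u : UnitAddTorus d → EuclideanSpace ℝ d} (hu : Integrable u volume)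
    {ε : ℝ} (hε : 0 < ε) (hε' : ε ≤ 1 / 4) : IsSmooth (vecMollify ε u) := by
  rw [IsSmooth, contDiff_euclidean]
  intro i
  exact isSmooth_convolution (hu.eval_piLp i) (isSmooth_kernel hε hε')

end Vec

/-! ## Componentwise time averages of vector fields -/

section TimeVec

/-- The componentwise time average of a space–time vector field `U : ℝ → T^d → ℝ^d`:
`(timeAvgVec r U t y)ᵢ = timeAvgWith r Uᵢ t y`. (It agrees with the vector-valued fibre
convolution `timeAvgWith r U t` at a.e. `y`; the componentwise form is defined everywhere and is
the one mollified in space.) [folklore] -/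
def timeAvgVec (r : ℝ → ℝ) (U : ℝ → UnitAddTorus d → EuclideanSpace ℝ d) (t : ℝ)
    (y : UnitAddTorus d) : EuclideanSpace ℝ d :=
  WithLp.toLp 2 fun i => timeAvgWith r (fun s y => U s y i) t y

omit [Fintype d] in
/-- Components of the vector time average. [folklore] -/
@[simp]
theorem timeAvgVec_apply (r : ℝ → ℝ) (U : ℝ → UnitAddTorus d → EuclideanSpace ℝ d) (t : ℝ)
    (y : UnitAddTorus d) (i : d) : timeAvgVec r U t y i = timeAvgWith r (fun s y => U s y i) t y :=
  rfl

omit [Fintype d] in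
/-- The vector time average of the zero field vanishes. [folklore] -/
@[simp]
theorem timeAvgVec_zero (r : ℝ → ℝ) :
    timeAvgVec r (0 : ℝ → UnitAddTorus d → EuclideanSpace ℝ d) = 0 := by
  funext t y
  ext i
  simp [timeAvgVec_apply, timeAvgWith_apply]

end TimeVec

/-! ## The product space–time kernel on `ℝ × ℝ^d` -/

section Kernel

/-- The product space–time kernel `K(s, v) = r(s) ρ_ε(v)` on `ℝ × ℝ^d` (time kernel `r`, spatial
profile `Torus.profile ε`): the lift to `ℝ × ℝ^d` of mollification in time by `r` and in space
by `Torus.kernel ε`. [folklore] -/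
def stKernel (r : ℝ → ℝ) (ε : ℝ) (p : ℝ × EuclideanSpace ℝ d) : ℝ :=
  r p.1 * profile ε p.2

/-- Unfolding lemma for `stKernel`. [folklore] -/
@[simp]
theorem stKernel_apply (r : ℝ → ℝ) (ε : ℝ) (p : ℝ × EuclideanSpace ℝ d) :
    stKernel r ε p = r p.1 * profile ε p.2 := rfl

/-- The space–time kernel is smooth when the time kernel is. [folklore] -/
theorem contDiff_stKernel {r : ℝ → ℝ} (hr : ContDiff ℝ ∞ r) (ε : ℝ) :
    ContDiff ℝ ∞ (stKernel (d := d) r ε) :=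
  (hr.comp contDiff_fst).mul ((contDiff_profile ε).comp contDiff_snd)

/-- The space–time kernel is continuous when the time kernel is. [folklore] -/
theorem continuous_stKernel {r : ℝ → ℝ} (hr : Continuous r) (ε : ℝ) :
    Continuous (stKernel (d := d) r ε) :=
  (hr.comp continuous_fst).mul ((contDiff_profile ε).continuous.comp continuous_snd)

/-- The space–time kernel has compact support when the time kernel has (`0 < ε`). [folklore] -/
theorem hasCompactSupport_stKernel {r : ℝ → ℝ} (hrc : HasCompactSupport r) {ε : ℝ} (hε : 0 < ε) :
    HasCompactSupport (stKernel (d := d) r ε) := by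
  refine HasCompactSupport.of_support_subset_isCompact
    (hrc.isCompact.prod (isCompact_closedBall (0 : EuclideanSpace ℝ d) ε)) fun p hp => ?_
  rw [mem_support, stKernel_apply, mul_ne_zero_iff] at hp
  exact ⟨subset_tsupport _ hp.1, (support_profile_subset hε).trans ball_subset_closedBall hp.2⟩

end Kernel

/-! ## The space–time mollified field and the Constantin–E–Titi test field -/

section CET

/-- **The space–time mollification of a velocity field** `U : ℝ → T^d → ℝ^d`: time average by
the normalised bump `ρ = φ.normed volume`, then componentwise spatial mollification by
`Torus.kernel ε`, i.e. `(w t)ᵢ = (ρ ⋆ₜ Uᵢ)(t) ⋆ₓ k_ε` (Constantin–E–Titi 1994, p. 208: "we will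
proceed as if the solution is differentiable in time. The extra arguments needed to mollify in
time are straightforward"; this is that mollification in time composed with `u^ε = u * φ^ε`).
[cite: ConstantinETiti1994, p. 208] -/
def mollifiedField (φ : ContDiffBump (0 : ℝ)) (ε : ℝ) (U : ℝ → UnitAddTorus d → EuclideanSpace ℝ d)
    (t : ℝ) : UnitAddTorus d → EuclideanSpace ℝ d :=
  vecMollify ε (timeAvgVec (φ.normed volume) U t)

/-- Components of the space–time mollified field:
`(mollifiedField φ ε U t x)ᵢ = ((timeAvgWith ρ Uᵢ t) ⋆ kernel ε)(x)`. [folklore] -/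
@[simp]
theorem mollifiedField_apply (φ : ContDiffBump (0 : ℝ)) (ε : ℝ)
    (U : ℝ → UnitAddTorus d → EuclideanSpace ℝ d) (t : ℝ) (x : UnitAddTorus d) (i : d) :
    mollifiedField φ ε U t x i =
      ((timeAvgWith (φ.normed volume) (fun s y => U s y i) t) ⋆ kernel ε) x := rfl

/-- **The Constantin–E–Titi test field** built from a velocity field `U` and a scalar time
cut-off `η`: the space–time mollification of `η • w`, `w = mollifiedField φ ε U`, i.e.
`ψ t = vecMollify ε (timeAvgVec ρ (s ↦ η(s) • w(s)) t)`. This is the standard rigorous route to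
the mollified energy balance (11) of Constantin–E–Titi 1994, p. 209 (who "proceed as if the
solution is differentiable in time"): testing the weak formulation (1) with `ψ` and moving the
(even) mollifiers onto the solution produces `η`-weighted versions of both sides of (11). When
`U` is integrable on `ℝ × T^d` and weakly divergence free at a.e. time, `0 < ε ≤ 1/4` and `η` is
smooth with compact support, `ψ` is smooth in space–time, divergence free and compactly supported
in time (proved downstream, `FluidPDE/OnsagerTestField`). [cite: ConstantinETiti1994, p. 209] -/
def cetTestField (φ : ContDiffBump (0 : ℝ)) (ε : ℝ) (η : ℝ → ℝ)
    (U : ℝ → UnitAddTorus d → EuclideanSpace ℝ d) (t : ℝ) : UnitAddTorus d → EuclideanSpace ℝ d :=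
  vecMollify ε (timeAvgVec (φ.normed volume) (fun s y => η s • mollifiedField φ ε U s y) t)

/-- Components of the test field:
`(cetTestField φ ε η U t x)ᵢ = ((timeAvgWith ρ (s y ↦ η(s) wᵢ(s,y)) t) ⋆ kernel ε)(x)`. [folklore] -/
@[simp]
theorem cetTestField_apply (φ : ContDiffBump (0 : ℝ)) (ε : ℝ) (η : ℝ → ℝ)
    (U : ℝ → UnitAddTorus d → EuclideanSpace ℝ d) (t : ℝ) (x : UnitAddTorus d) (i : d) :
    cetTestField φ ε η U t x i =
      ((timeAvgWith (φ.normed volume) (fun s y => η s * mollifiedField φ ε U s y i) t) ⋆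
        kernel ε) x := by
  simp only [cetTestField, vecMollify_apply, timeAvgVec_apply, PiLp.smul_apply, smul_eq_mul]

/-- The mollified field of the zero velocity field vanishes. [folklore] -/
@[simp]
theorem mollifiedField_zero (φ : ContDiffBump (0 : ℝ)) (ε : ℝ) :
    mollifiedField φ ε (0 : ℝ → UnitAddTorus d → EuclideanSpace ℝ d) = 0 := by
  funext t
  simp [mollifiedField]

end CET

end Torus

end Literature.Analysis.FunctionSpaces
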